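import Summits.BirchSwinnertonDyer.Rank1Residual.X11b.FrameIdealRigidity
import Summits.BirchSwinnertonDyer.Rank1Residual.X11b.BDPRouteOpenInputSplitRecord
import HarnessLib

/-!
# Class X11b, route p2 at `p ≥ 5`: the open statement (2.4)∃♭ DOES NOT SEE THE FRAME — by IDEAL
# RIGIDITY ACROSS PERIODS, "(2.4) for SOME BDP frame" ⟺ "(2.4) for EVERY BDP frame" ⟺ "(2.4) for
# EVERY Hsieh witness", i.e. the erratum's divisibility is a property of Hsieh's PUBLISHED object
# (cell `b2b-bsdres`, sub-cell `multr1-p2`, gen 26)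

HONEST FRAMING (cell `b2b-bsdres`, run/shared/lean/b2b/bsd-rank1-residual/, verbatim in every
file): the goal of the cell is to DELETE the COMBINATION-SHAPED residual classes of the
Birch–Swinnerton-Dyer formula for ALL analytic-rank `≤ 1` elliptic curves over `ℚ` — "full BSD
formula for every rank `≤ 1` curve in class `C`" assembled STRICTLY from published theorems — so
that the rank-`≤ 1` remainder becomes exactly the CONSTRUCTION-SHAPED classes, which are TYPED
(missing-input `Prop`s), NOT attempted. This is not "finishing BSD". Sub-cell `multr1-p2` is a
RESEARCH ROUTE on class X11b (`ClassX11b W p := r_an = 1 ∧ p ≠ 2 ∧ mult(p) ∧ irr(p)`,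
`Partition/Rows.lean`); no claim beyond the stated class and loci; X11b's label does not change;
NOTHING is booked by this file.

TWO `Prop`-VALUED SHAPES (`P2.IMCDivAllFramesOnTree`, `P2.IMCDivHsiehWitnessOnTree` — both OPEN,
conjecture-tagged since gen 29 (claim-tagged in gens 26–28), nothing asserted; the ∀-twins of gen 25's
`P2.IMCDivSomeFrameOnTree`) and THEOREMS. No named fact is introduced. SCOPE (gen 29, doc + tag only;
verbatim sources in `X11b/BDPRouteOpenInputDescent.lean`): both shapes live at CLASSICAL Heegner data
(every `ℓ ∣ N_E` split in `K`), whereas the erratum's "(2.4) … By [FW21, Thm. 4.41]" needs "there exists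
`q ∥ N` … not split in `K`" (arXiv:2107.13726v3 Thm. 4.41; [Castella2018, p. 4]; [Castella2024, Thm. 3.1
(iii)]) — a derivation at R1's ERRATUM fields, typed as `P2.IMCDivIntFrameAtErratumData` (gen 28); at
classical fields print has [BurungaleCastellaSkinner2025, Thm. 1.2.4] (GOOD ORDINARY `p`) and, at `p ∥ N`,
only STEP L ([SkinnerZhang2014] Thm. 1.2, PREPRINT). NO announced derivation of these shapes: `@[conjecture]`.

## Why (gen 26, after multr1-p1's `R1.span_singleton_eq_of_isBDPLFunctionInt`)

Since gen 25 route p2's ONE open statement is (2.4)∃♭ `P2.IMCDivSomeFrameOnTree W p`: per datum SOME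
♭-frame `(Ω_K ≠ 0, ‖Ω_p‖ = 1, Q ∈ 𝓞_{ℂ_p}⟦T⟧)` with Castella's interpolation [3.1♭] and the erratum's
divisibility `Ch_Λ(X_ac)·𝓞_{ℂ_p}⟦T⟧ ⊆ (Q)` [(2.4)♭]. Gen 25's honest caveat (a): "(2.4) for Castella's
`L_p(f)`", "(2.4) for Hsieh's `𝒫_Σ(π,λ)²` (re-normalised)" and "(2.4) for some frame" are A PRIORI
different — the ideal `(Q)` moves with the periods unless the period ratio is harmless. multr1-p1's
IDEAL RIGIDITY ACROSS PERIODS (`X11b/FrameIdealRigidity.lean`, gen 25 of route R1: two ♭-frames of the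
same `(ι, 𝔭, κ, γ, f)` with ANY non-zero periods differ by a UNIT of `𝓞_{ℂ_p}⟦T⟧`, at an odd prime over
an imaginary quadratic field with `κ` anticyclotomic) removes the caveat. This file draws the
consequences for route p2:

* §1 datum lemmas: `R1.le_span_singleton_iff_of_isBDPLFunctionInt` (any ideal lies in `(Q)` iff in
  `(Q')`); **`span_singleton_eq_of_isHsiehLFunction_of_isBDPLFunctionInt`** (a Hsieh witness
  `IsHsiehLFunction ι' 𝔭 κ γ f A Ω_K C Ω_p Q` — `0 < A`, `‖ι'⁻¹C‖ = 1`, `Ω_p ≠ 0` — and a ♭-frame of the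
  same `(ι', 𝔭, κ, γ, f)` at `p ∣ N` generate the SAME ideal: gen 24's Hsieh→♭ glue
  `exists_isBDPLFunctionInt_of_isHsiehLFunction` + ideal rigidity); `span_singleton_eq_of_isHsiehLFunction`
  (two Hsieh witnesses with ANY admissible constants generate the same ideal).
* §2 shapes on the SAME data as `P2.IMCDivSomeFrameOnTree` (binders verbatim): **`P2.IMCDivAllFramesOnTree
  W p`** — (2.4)♭ for EVERY ♭-frame `(Ω_K ≠ 0, Ω_p ≠ 0, Q)` with 3.1♭ — and **`P2.IMCDivHsiehWitnessOnTree
  W p`** — (2.4) for EVERY Hsieh witness at the datum (the open statement READ ON HSIEH'S PUBLISHED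
  OBJECT `𝒫_Σ(π_f, λ)²`, Hsieh 2014 Thm. 1; gen 25 stated this hypothesis inline).
* §3 UNCONDITIONAL implications: **`P2.imcDivAllFramesOnTree_of_imcDivSomeFrame`** ((2.4)∃♭ ⟹ (2.4)∀♭,
  ideal rigidity), **`P2.imcDivHsiehWitnessOnTree_of_imcDivAllFrames`** ((2.4)∀♭ ⟹ (2.4) for every Hsieh
  witness, glue), `P2.imcDivHsiehWitnessOnTree_of_imcDivSomeFrame`; and
  `P2.imcDivSomeFrameOnTree_of_exists_hsiehWitness_dvd` ((2.4) for SOME Hsieh witness at every datum ⟹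
  (2.4)∃♭, glue) — so "some Hsieh witness" ⟹ "every Hsieh witness" with NO hypothesis.
* §4 given `hH` (Hsieh 2014 Thm. 1, PUBLISHED; a frame EXISTS at every datum by gen 25's
  `P2.exists_isBDPLFunctionInt_datum_of_hsieh2014_supplied`): `P2.imcDivSomeFrameOnTree_of_imcDivAllFrames_of_hsieh2014`,
  `P2.imcDivSomeFrameOnTree_of_imcDivHsiehWitness_of_hsieh2014`, and the EQUIVALENCES
  **`P2.imcDivSomeFrameOnTree_iff_imcDivAllFrames_of_hsieh2014`**,
  **`P2.imcDivSomeFrameOnTree_iff_imcDivHsiehWitness_of_hsieh2014`**,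
  `P2.imcDivAllFramesOnTree_iff_imcDivHsiehWitness_of_hsieh2014`.

HONEST READING for the registry (no fact filed, no mark): route p2's open statement is ONE property of
ONE published object per datum — the erratum's divisibility `Ch_Λ(X_ac^∅(E[p^∞]))·𝓞_{ℂ_p}⟦T⟧ ⊆
(𝒫_Σ(π_f,λ)²)` for Hsieh's anticyclotomic Rankin–Selberg `p`-adic `L`-function in ANY of its
normalisations ([Castella2018Erratum (2.4)] transcribed to classical data; NO announced derivation —
SCOPE above); the ∃-frame / ∀-frame / Hsieh-witness currencies AGREE given Hsieh 2014 Thm. 1. The records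
(`P2.bsdp_of_semistable_of_imcDivSomeFrame`, `P2.bsdp_of_onTree_split`) are unchanged and may be fed from
any of the three shapes. CONDITIONAL; nothing booked; labels UNCHANGED; X11b stays CONSTRUCTION-SHAPED.
(R1's equality twin: `R1.imcEqIntAt_iff_of_isBDPLFunctionInt`; the `p = 3` instances are x11b3's.)

References: [Castella2018] §1 (1.b), p. 4, Thm. 3.1 (arXiv:1704.06608 pp. 3, 4, 9); [Castella2018Erratum] (2.4),
Thm. 1.1; [FouquetWan2021] Thm. 4.41, [Castella2024] Thm. 3.1, [SkinnerZhang2014] Thm. 1.2 (PREPRINTS);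
[BurungaleCastellaSkinner2025] Thm. 1.2.4; [CastellaHsieh2018] §3.3; [Hsieh2014] Thm. 1, p. 7; [Washington1997] §5.1.
-/

noncomputable section

open scoped Classical NumberField

open WeierstrassCurve NumberField IsDedekindDomain Field PowerSeries
open Literature.NumberTheory.EllipticCurves Literature.NumberTheory.EllipticCurves.GreenbergSelmer
open Literature.NumberTheory.EllipticCurves.ModularForms
open Literature.NumberTheory.EllipticCurves.Rank1Residual
open Literature.NumberTheory.EllipticCurves.Rank1Residual.Typed
open Literature.NumberTheory.EllipticCurves.Castella2018
open Literature.NumberTheory.QuadraticFields.Quadratic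
open Literature.NumberTheory.GaloisRepresentations Literature.NumberTheory.GaloisCohomology
open Summit.BirchSwinnertonDyer.Rank1Residual.X11b.AcSelmer

namespace Summit.BirchSwinnertonDyer.Rank1Residual.X11b

/-! ### §1 Datum lemmas: ideals of frames and of Hsieh witnesses -/

section Datum

variable {p : ℕ} [Fact p.Prime] {K : Type} [Field K] [NumberField K] {N : ℕ}
  {ι' : PadicAlgCl p ≃+* ℂ} {𝔭 : HeightOneSpectrum (𝓞 K)} {κ : ZpExtension K p}
  {γ : Field.absoluteGaloisGroup K} {f : CuspForm (CongruenceSubgroup.Gamma0 N) 2}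

/-- **Membership in `(Q)` does not see the frame**: for two ♭-frames `(Ω_K, Ω_p, Q)`, `(Ω_K', Ω_p', Q')`
of the same `(ι', 𝔭, κ, γ, f)` with non-zero periods (odd `p`, `K` imaginary quadratic, `κ`
anticyclotomic, `γ` a topological generator) and ANY ideal `I` of `𝓞_{ℂ_p}⟦T⟧`: `I ≤ (Q) ↔ I ≤ (Q')`
(multr1-p1's `R1.span_singleton_eq_of_isBDPLFunctionInt`). [cite: Castella2018, Thm. 3.1 (arXiv:1704.06608 p. 9)] -/
theorem R1.le_span_singleton_iff_of_isBDPLFunctionInt (hp2 : p ≠ 2) (hK : IsImaginaryQuadratic K)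
    (hκ : κ.IsAnticyclotomic) (hγ : κ.IsTopGenerator γ) {ΩK ΩK' : ℂ} {Ωp Ωp' : ℂ_[p]}
    {Q Q' : PowerSeries 𝓞_ℂ_[p]} (hΩK : ΩK ≠ 0) (hΩK' : ΩK' ≠ 0) (hΩp : Ωp ≠ 0) (hΩp' : Ωp' ≠ 0)
    (hQ : R1.IsBDPLFunctionInt p ι' 𝔭 κ γ f ΩK Ωp Q) (hQ' : R1.IsBDPLFunctionInt p ι' 𝔭 κ γ f ΩK' Ωp' Q')
    (I : Ideal (PowerSeries 𝓞_ℂ_[p])) :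
    I ≤ Ideal.span {Q} ↔ I ≤ Ideal.span {Q'} := by
  rw [R1.span_singleton_eq_of_isBDPLFunctionInt hp2 hK hκ hγ hΩK hΩK' hΩp hΩp' hQ hQ']

/-- **A Hsieh witness and a ♭-frame generate the same ideal.** At `p ∣ N` (odd `p`, `K` imaginary
quadratic, `κ` anticyclotomic, `γ` a topological generator): a Hsieh witness `(A, Ω_K, C, Ω_p, Q)` —
`IsHsiehLFunction ι' 𝔭 κ γ f A Ω_K C Ω_p Q` with `0 < A`, `Ω_K ≠ 0`, `‖ι'⁻¹C‖ = 1`, `Ω_p ≠ 0` — and a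
♭-frame `R1.IsBDPLFunctionInt p ι' 𝔭 κ γ f Ω_K' Ω_p' Q'` with non-zero periods have `(Q) = (Q')`: gen 24's
glue re-normalises the Hsieh witness into the ♭-frame `((16A²/p)^{1/4}Ω_K, Ω_p, (ι'⁻¹C)⁻¹·Q)`, whose
ideal is `(Q)` (unit constant) and equals `(Q')` by ideal rigidity across periods.
[cite: Hsieh2014, Thm. 1 (arXiv:1112.1580 p. 4)] [cite: Castella2018, Thm. 3.1 (arXiv:1704.06608 p. 9)] -/
theorem span_singleton_eq_of_isHsiehLFunction_of_isBDPLFunctionInt [NeZero N] (hp2 : p ≠ 2)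
    (hK : IsImaginaryQuadratic K) (hκ : κ.IsAnticyclotomic) (hγ : κ.IsTopGenerator γ) (hpN : p ∣ N)
    {A : ℝ} (hA : 0 < A) {ΩK C : ℂ} (hΩK : ΩK ≠ 0) (hC : ‖((ι'.symm C : PadicAlgCl p) : ℂ_[p])‖ = 1)
    {Ωp : ℂ_[p]} (hΩp : Ωp ≠ 0) {Q : PowerSeries 𝓞_ℂ_[p]}
    (hQ : IsHsiehLFunction ι' 𝔭 κ γ f A ΩK C Ωp Q) {ΩK' : ℂ} {Ωp' : ℂ_[p]}
    {Q' : PowerSeries 𝓞_ℂ_[p]} (hΩK' : ΩK' ≠ 0) (hΩp' : Ωp' ≠ 0)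
    (hQ' : R1.IsBDPLFunctionInt p ι' 𝔭 κ γ f ΩK' Ωp' Q') :
    Ideal.span ({Q} : Set (PowerSeries 𝓞_ℂ_[p])) = Ideal.span {Q'} := by
  obtain ⟨ΩK₁, c, hΩK₁, hc, hBDP⟩ :=
    exists_isBDPLFunctionInt_of_isHsiehLFunction ι' 𝔭 κ γ f hpN hA hΩK hC Ωp hQ
  have h1 : Ideal.span ({PowerSeries.C c * Q} : Set (PowerSeries 𝓞_ℂ_[p])) = Ideal.span {Q} :=
    Ideal.span_singleton_mul_left_unit
      ((isUnit_padicComplexInt_of_norm_eq_one hc).map PowerSeries.C) Q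
  have h2 := R1.span_singleton_eq_of_isBDPLFunctionInt hp2 hK hκ hγ hΩK' hΩK₁ hΩp' hΩp hQ' hBDP
  exact h1.symm.trans h2

/-- **Two Hsieh witnesses generate the same ideal**, whatever their constants `(A, Ω_K, C, Ω_p)`,
`(A', Ω_K', C', Ω_p')` (both admissible: `0 < A`, `Ω_K ≠ 0`, `‖ι'⁻¹C‖ = 1`, `Ω_p ≠ 0`), at `p ∣ N`
(odd `p`, `K` imaginary quadratic, `κ` anticyclotomic, `γ` a topological generator).
[cite: Hsieh2014, Thm. 1 (arXiv:1112.1580 p. 4)] [cite: Castella2018, Thm. 3.1 (arXiv:1704.06608 p. 9)] -/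
theorem span_singleton_eq_of_isHsiehLFunction [NeZero N] (hp2 : p ≠ 2) (hK : IsImaginaryQuadratic K)
    (hκ : κ.IsAnticyclotomic) (hγ : κ.IsTopGenerator γ) (hpN : p ∣ N)
    {A A' : ℝ} (hA : 0 < A) (hA' : 0 < A') {ΩK C ΩK' C' : ℂ} (hΩK : ΩK ≠ 0) (hΩK' : ΩK' ≠ 0)
    (hC : ‖((ι'.symm C : PadicAlgCl p) : ℂ_[p])‖ = 1) (hC' : ‖((ι'.symm C' : PadicAlgCl p) : ℂ_[p])‖ = 1)
    {Ωp Ωp' : ℂ_[p]} (hΩp : Ωp ≠ 0) (hΩp' : Ωp' ≠ 0) {Q Q' : PowerSeries 𝓞_ℂ_[p]}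
    (hQ : IsHsiehLFunction ι' 𝔭 κ γ f A ΩK C Ωp Q) (hQ' : IsHsiehLFunction ι' 𝔭 κ γ f A' ΩK' C' Ωp' Q') :
    Ideal.span ({Q} : Set (PowerSeries 𝓞_ℂ_[p])) = Ideal.span {Q'} := by
  obtain ⟨ΩK₁, c, hΩK₁, hc, hBDP⟩ :=
    exists_isBDPLFunctionInt_of_isHsiehLFunction ι' 𝔭 κ γ f hpN hA' hΩK' hC' Ωp' hQ'
  have h1 : Ideal.span ({PowerSeries.C c * Q'} : Set (PowerSeries 𝓞_ℂ_[p])) = Ideal.span {Q'} :=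
    Ideal.span_singleton_mul_left_unit
      ((isUnit_padicComplexInt_of_norm_eq_one hc).map PowerSeries.C) Q'
  rw [← h1]
  exact span_singleton_eq_of_isHsiehLFunction_of_isBDPLFunctionInt hp2 hK hκ hγ hpN hA hΩK hC hΩp hQ
    hΩK₁ hΩp' hBDP

end Datum

/-! ### §2 The two ∀-shapes on route p2's data -/

section Shape

variable (W : WeierstrassCurve ℚ) [W.IsElliptic] [W.IsGloballyMinimal] (p : ℕ) [Fact p.Prime]

/-- **(2.4)∀♭ — the erratum's IMC divisibility for EVERY BDP frame (OPEN shape, ∀-currency).** At every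
datum of `P2.IMCDivSomeFrameOnTree W p` (binders verbatim: `(E,p)` in X11b, `p ≥ 5`, `ρ̄` onto; `K`
imaginary quadratic with `d_K` odd, `p ∤ d_K`, `p ∤ #𝓞_K^×`, every `ℓ ∣ N_E` split, `L(E^{d_K},1) ≠ 0`;
parametrisation datum `Dt` of level `N_E` with `p ∤ c`; non-torsion Heegner point; anticyclotomic
`(κ, γ)`; `ι'`, `w₀`, `P'`, `e` inducing `𝔭_{ι'}`): for EVERY frame `(Ω_K ≠ 0, Ω_p ≠ 0, Q ∈ 𝓞_{ℂ_p}⟦T⟧)`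
with Castella's interpolation property `R1.IsBDPLFunctionInt p ι' 𝔭_{ι'} κ γ f_{Dt} Ω_K Ω_p Q` [Thm. 3.1],
`Ch_Λ(X_ac^∅(E[p^∞]))·𝓞_{ℂ_p}⟦T⟧ ⊆ (Q)` [the erratum's display (2.4) TRANSCRIBED to classical data; NO
announced derivation here (FW21 Thm. 4.41 needs a prime `q ∥ N` not split in `K`) — SCOPE, file
docstring, gen 29]. Vacuous at a datum without a frame (none such given Hsieh 2014 Thm. 1); EQUIVALENT
to the ∃-shape given that fact (`P2.imcDivSomeFrameOnTree_iff_imcDivAllFrames_of_hsieh2014`) and implied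
by it outright (`P2.imcDivAllFramesOnTree_of_imcDivSomeFrame`). An instance of the Iwasawa–Greenberg main
conjecture for `X_ac(E[p^∞])` at `p ∥ N` and classical fields; a predicate on `(W, p)`; OPEN; NEVER a
theorem in this cell; every result using it is CONDITIONAL.
[cite: Castella2018, §1 (1.b) (arXiv:1704.06608 p. 3) and Thm. 3.1, display (3.2) (p. 9) (conjecture display and frame; shape only; nothing asserted)]
[cite: Castella2018Erratum, (2.4) (p. 4) (display transcribed; its derivation there assumes a prime of N non-split in K; nothing asserted)] -/
@[conjecture]
def P2.IMCDivAllFramesOnTree : Prop :=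
  ∀ (N : ℕ) [NeZero N] (K : Type) [Field K] [NumberField K]
    (Dt : ModularParametrizationData W N) (H : HeegnerDatum N (NumberField.discr K)) (ι : K →+* ℂ)
    (P : (W.baseChange K).toAffine.Point),
    ClassX11b W p → 5 ≤ p → Surj W p → W.conductorNorm ℤ = N → IsImaginaryQuadratic K →
    Odd (NumberField.discr K) → ¬ (p : ℤ) ∣ NumberField.discr K → ¬ p ∣ Units.torsionOrder K →
    SatisfiesHeegnerHypothesis N K →
    (W.quadraticTwist (NumberField.discr K : ℚ)).entireLFunction 1 ≠ 0 →
    WeierstrassCurve.Affine.Point.map ι.toRatAlgHom P = heegnerPointComplex Dt H →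
    ¬ (p : ℤ) ∣ Dt.c → ¬ IsOfFinAddOrder P →
    ∀ (κ : ZpExtension K p), κ.IsAnticyclotomic →
      ∀ (γ : Field.absoluteGaloisGroup K) [Fact (κ.IsTopGenerator γ)]
        (ι' : PadicAlgCl p ≃+* ℂ) (w₀ : InfinitePlace K) (P' : (W.baseChange K).toAffine.Point),
        WeierstrassCurve.Affine.Point.map w₀.embedding.toRatAlgHom P' = heegnerPointComplex Dt H →
        ∀ (e : K →+* ℚ_[p]),
          (∀ k : 𝓞 K, k ∈ (primeOfEmbeddingDatum p ι' w₀.embedding).asIdeal ↔ ‖e (k : K)‖ < 1) →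
          ∀ (ΩK : ℂ) (Ωp : ℂ_[p]) (Q : PowerSeries 𝓞_ℂ_[p]), ΩK ≠ 0 → Ωp ≠ 0 →
            R1.IsBDPLFunctionInt p ι' (primeOfEmbeddingDatum p ι' w₀.embedding) κ γ Dt.f ΩK Ωp Q →
            (XAc.charIdeal (W.baseChange K) p κ (primeOfEmbeddingDatum p ι' w₀.embedding) ∅ γ).map
              (PowerSeries.map (R1.toCpInt p)) ≤ Ideal.span {Q}

/-- **(2.4) READ ON HSIEH'S PUBLISHED OBJECT — the erratum's divisibility for EVERY Hsieh witness
(OPEN shape, ∀-currency).** At every datum (same binders): for EVERY Hsieh witness `(A, Ω_K, C, Ω_p, Q)`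
— `0 < A`, `Ω_K ≠ 0`, `‖ι'⁻¹C‖ = 1`, `Ω_p ≠ 0`, `IsHsiehLFunction ι' 𝔭_{ι'} κ γ f_{Dt} A Ω_K C Ω_p Q`
(Hsieh 2014 Thm. 1's interpolation property of `Q = [g]⁻¹·Tw_{λ̂⁻¹}(𝒫_Σ(π_f, λ)²) ∈ 𝓞_{ℂ_p}⟦T⟧`; such a
witness EXISTS at every datum by the published fact, `P2.exists_isHsiehLFunction_of_hsieh2014`) —
`Ch_Λ(X_ac^∅(E[p^∞]))·𝓞_{ℂ_p}⟦T⟧ ⊆ (Q)`. Gen 25 stated this hypothesis inline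
(`P2.imcDivSomeFrameOnTree_of_hsieh2014_of_forall_hsiehWitness_dvd`, with `‖Ω_p‖ = 1`); EQUIVALENT to
(2.4)∃♭ given Hsieh's fact (`P2.imcDivSomeFrameOnTree_iff_imcDivHsiehWitness_of_hsieh2014`) and implied by
it outright. NO announced derivation at these classical data (SCOPE, file docstring, gen 29); a
predicate on `(W, p)`; OPEN; NEVER a theorem in this cell; every result using it is CONDITIONAL.
[cite: Hsieh2014, Thm. 1 (arXiv:1112.1580 pp. 3–4) (the object; shape only, nothing asserted)]
[cite: Castella2018, §1 (1.b) (arXiv:1704.06608 p. 3) (conjecture display; shape only; nothing asserted)] -/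
@[conjecture]
def P2.IMCDivHsiehWitnessOnTree : Prop :=
  ∀ (N : ℕ) [NeZero N] (K : Type) [Field K] [NumberField K]
    (Dt : ModularParametrizationData W N) (H : HeegnerDatum N (NumberField.discr K)) (ι : K →+* ℂ)
    (P : (W.baseChange K).toAffine.Point),
    ClassX11b W p → 5 ≤ p → Surj W p → W.conductorNorm ℤ = N → IsImaginaryQuadratic K →
    Odd (NumberField.discr K) → ¬ (p : ℤ) ∣ NumberField.discr K → ¬ p ∣ Units.torsionOrder K →
    SatisfiesHeegnerHypothesis N K →
    (W.quadraticTwist (NumberField.discr K : ℚ)).entireLFunction 1 ≠ 0 →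
    WeierstrassCurve.Affine.Point.map ι.toRatAlgHom P = heegnerPointComplex Dt H →
    ¬ (p : ℤ) ∣ Dt.c → ¬ IsOfFinAddOrder P →
    ∀ (κ : ZpExtension K p), κ.IsAnticyclotomic →
      ∀ (γ : Field.absoluteGaloisGroup K) [Fact (κ.IsTopGenerator γ)]
        (ι' : PadicAlgCl p ≃+* ℂ) (w₀ : InfinitePlace K) (P' : (W.baseChange K).toAffine.Point),
        WeierstrassCurve.Affine.Point.map w₀.embedding.toRatAlgHom P' = heegnerPointComplex Dt H →
        ∀ (e : K →+* ℚ_[p]),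
          (∀ k : 𝓞 K, k ∈ (primeOfEmbeddingDatum p ι' w₀.embedding).asIdeal ↔ ‖e (k : K)‖ < 1) →
          ∀ (A : ℝ) (ΩK C : ℂ) (Ωp : ℂ_[p]) (Q : PowerSeries 𝓞_ℂ_[p]),
            0 < A → ΩK ≠ 0 → ‖((ι'.symm C : PadicAlgCl p) : ℂ_[p])‖ = 1 → Ωp ≠ 0 →
            IsHsiehLFunction ι' (primeOfEmbeddingDatum p ι' w₀.embedding) κ γ Dt.f A ΩK C Ωp Q →
            (XAc.charIdeal (W.baseChange K) p κ (primeOfEmbeddingDatum p ι' w₀.embedding) ∅ γ).map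
              (PowerSeries.map (R1.toCpInt p)) ≤ Ideal.span {Q}

end Shape

/-! ### §3 Unconditional implications: ∃ ⟹ ∀ (ideal rigidity), ∀♭ ⟹ ∀-Hsieh (glue) -/

section Unconditional

variable {W : WeierstrassCurve ℚ} [W.IsElliptic] [W.IsGloballyMinimal] {p : ℕ} [Fact p.Prime]

omit [W.IsElliptic] [W.IsGloballyMinimal] in
/-- **(2.4)∃♭ ⟹ (2.4)∀♭ on EVERY pair** (ideal rigidity across periods at the datum: `p ≠ 2` from
X11b, `K` imaginary quadratic, `κ` anticyclotomic, `γ` a topological generator — all binders of the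
datum; the ∃-frame has `‖Ω_p‖ = 1`, so `Ω_p ≠ 0`). CONDITIONAL on (2.4)∃♭; nothing booked.
[claim: Castella2018Erratum, status: under-review] [cite: Castella2018, Thm. 3.1 (arXiv:1704.06608 p. 9)] -/
theorem P2.imcDivAllFramesOnTree_of_imcDivSomeFrame (hD : P2.IMCDivSomeFrameOnTree W p) :
    P2.IMCDivAllFramesOnTree W p := by
  intro N _ K _ _ Dt H ιK P hX h5 hs hN hK hodd hpd hμ hHN hLt hP hc hPinf κ hκ γ hγ ι' w₀ P' hP' e he
    ΩK' Ωp' Q' hΩK' hΩp' hQ'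
  obtain ⟨ΩK, Ωp, Q, hΩK, hΩp, hQ, hdiv⟩ :=
    hD N K Dt H ιK P hX h5 hs hN hK hodd hpd hμ hHN hLt hP hc hPinf κ hκ γ ι' w₀ P' hP' e he
  have hΩp0 : Ωp ≠ 0 := fun h ↦ by rw [h, norm_zero] at hΩp; exact zero_ne_one hΩp
  exact (R1.le_span_singleton_iff_of_isBDPLFunctionInt hX.2.1 hK hκ hγ.out hΩK hΩK' hΩp0 hΩp' hQ hQ'
    _).mp hdiv

omit [W.IsGloballyMinimal] in
/-- **(2.4)∀♭ ⟹ (2.4) for EVERY Hsieh witness on EVERY pair** (gen 24's glue: a Hsieh witness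
re-normalises into a ♭-frame with the same ideal; `p ∣ N_E` from `Mult`). CONDITIONAL on (2.4)∀♭;
nothing booked. [claim: Castella2018Erratum, status: under-review] [cite: Hsieh2014, Thm. 1 (arXiv:1112.1580 p. 4)] -/
theorem P2.imcDivHsiehWitnessOnTree_of_imcDivAllFrames (hA : P2.IMCDivAllFramesOnTree W p) :
    P2.IMCDivHsiehWitnessOnTree W p := by
  intro N _ K _ _ Dt H ιK P hX h5 hs hN hK hodd hpd hμ hHN hLt hP hc hPinf κ hκ γ hγ ι' w₀ P' hP' e he
    A ΩK C Ωp Q hA0 hΩK hC hΩp hQ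
  have hpN : p ∣ N := hN ▸ dvd_conductorNorm_of_mult hX.2.2.1
  obtain ⟨ΩK₁, c, hΩK₁, hcu, hBDP⟩ :=
    exists_isBDPLFunctionInt_of_isHsiehLFunction ι' _ κ γ Dt.f hpN hA0 hΩK hC Ωp hQ
  have hdiv := hA N K Dt H ιK P hX h5 hs hN hK hodd hpd hμ hHN hLt hP hc hPinf κ hκ γ ι' w₀ P' hP' e he
    ΩK₁ Ωp (PowerSeries.C c * Q) hΩK₁ hΩp hBDP
  rwa [Ideal.span_singleton_mul_left_unit
    ((isUnit_padicComplexInt_of_norm_eq_one hcu).map PowerSeries.C) Q] at hdiv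

omit [W.IsGloballyMinimal] in
/-- **(2.4)∃♭ ⟹ (2.4) for EVERY Hsieh witness** (composition of the two previous theorems): the
converse of gen 25's `P2.imcDivSomeFrameOnTree_of_hsieh2014_of_forall_hsiehWitness_dvd`, with NO
hypothesis. [claim: Castella2018Erratum, status: under-review] [cite: Hsieh2014, Thm. 1 (arXiv:1112.1580 p. 4)] -/
theorem P2.imcDivHsiehWitnessOnTree_of_imcDivSomeFrame (hD : P2.IMCDivSomeFrameOnTree W p) :
    P2.IMCDivHsiehWitnessOnTree W p :=
  P2.imcDivHsiehWitnessOnTree_of_imcDivAllFrames (P2.imcDivAllFramesOnTree_of_imcDivSomeFrame hD)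

omit [W.IsGloballyMinimal] in
/-- **(2.4) for SOME Hsieh witness at every datum ⟹ (2.4)∃♭** (glue only; no rigidity, no `hH`): if at
every datum THERE IS a Hsieh witness `(A, Ω_K, C, Ω_p, Q)` (`0 < A`, `Ω_K ≠ 0`, `‖ι'⁻¹C‖ = 1`,
`‖Ω_p‖ = 1`) carrying the erratum's divisibility, then route p2's open statement holds — witnessed by
the re-normalised frame `((16A²/p)^{1/4}Ω_K, Ω_p, (ι'⁻¹C)⁻¹Q)`. With
`P2.imcDivHsiehWitnessOnTree_of_imcDivSomeFrame`: "(2.4) for SOME Hsieh witness" ⟹ "(2.4) for EVERY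
Hsieh witness", unconditionally. [claim: Castella2018Erratum, status: under-review]
[cite: Hsieh2014, Thm. 1 (arXiv:1112.1580 p. 4)] [cite: Castella2018, Thm. 3.1 (arXiv:1704.06608 p. 9)] -/
theorem P2.imcDivSomeFrameOnTree_of_exists_hsiehWitness_dvd
    (hVD : ∀ (N : ℕ) [NeZero N] (K : Type) [Field K] [NumberField K]
      (Dt : ModularParametrizationData W N) (H : HeegnerDatum N (NumberField.discr K)) (ι : K →+* ℂ)
      (P : (W.baseChange K).toAffine.Point),
      ClassX11b W p → 5 ≤ p → Surj W p → W.conductorNorm ℤ = N → IsImaginaryQuadratic K →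
      Odd (NumberField.discr K) → ¬ (p : ℤ) ∣ NumberField.discr K → ¬ p ∣ Units.torsionOrder K →
      SatisfiesHeegnerHypothesis N K →
      (W.quadraticTwist (NumberField.discr K : ℚ)).entireLFunction 1 ≠ 0 →
      WeierstrassCurve.Affine.Point.map ι.toRatAlgHom P = heegnerPointComplex Dt H →
      ¬ (p : ℤ) ∣ Dt.c → ¬ IsOfFinAddOrder P →
      ∀ (κ : ZpExtension K p), κ.IsAnticyclotomic →
        ∀ (γ : Field.absoluteGaloisGroup K) [Fact (κ.IsTopGenerator γ)]
          (ι' : PadicAlgCl p ≃+* ℂ) (w₀ : InfinitePlace K) (P' : (W.baseChange K).toAffine.Point),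
          WeierstrassCurve.Affine.Point.map w₀.embedding.toRatAlgHom P' = heegnerPointComplex Dt H →
          ∀ (e : K →+* ℚ_[p]),
            (∀ k : 𝓞 K, k ∈ (primeOfEmbeddingDatum p ι' w₀.embedding).asIdeal ↔ ‖e (k : K)‖ < 1) →
            ∃ (A : ℝ) (ΩK C : ℂ) (Ωp : ℂ_[p]) (Q : PowerSeries 𝓞_ℂ_[p]),
              0 < A ∧ ΩK ≠ 0 ∧ ‖((ι'.symm C : PadicAlgCl p) : ℂ_[p])‖ = 1 ∧ ‖Ωp‖ = 1 ∧
              IsHsiehLFunction ι' (primeOfEmbeddingDatum p ι' w₀.embedding) κ γ Dt.f A ΩK C Ωp Q ∧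
              (XAc.charIdeal (W.baseChange K) p κ (primeOfEmbeddingDatum p ι' w₀.embedding) ∅ γ).map
                (PowerSeries.map (R1.toCpInt p)) ≤ Ideal.span {Q}) :
    P2.IMCDivSomeFrameOnTree W p := by
  intro N _ K _ _ Dt H ιK P hX h5 hs hN hK hodd hpd hμ hHN hLt hP hc hPinf κ hκ γ _ ι' w₀ P' hP' e he
  obtain ⟨A, ΩK, C, Ωp, Q, hA, hΩK, hC, hΩp, hQ, hdiv⟩ :=
    hVD N K Dt H ιK P hX h5 hs hN hK hodd hpd hμ hHN hLt hP hc hPinf κ hκ γ ι' w₀ P' hP' e he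
  have hpN : p ∣ N := hN ▸ dvd_conductorNorm_of_mult hX.2.2.1
  obtain ⟨ΩK₁, c', hΩK₁, hc', hBDP⟩ :=
    exists_isBDPLFunctionInt_of_isHsiehLFunction ι' _ κ γ Dt.f hpN hA hΩK hC Ωp hQ
  refine ⟨ΩK₁, Ωp, PowerSeries.C c' * Q, hΩK₁, hΩp, hBDP, ?_⟩
  rwa [Ideal.span_singleton_mul_left_unit
    ((isUnit_padicComplexInt_of_norm_eq_one hc').map PowerSeries.C) Q]

end Unconditional

/-! ### §4 Given Hsieh 2014 Thm. 1 (a frame EXISTS at every datum): the three currencies AGREE -/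

section Hsieh

variable {W : WeierstrassCurve ℚ} [W.IsElliptic] [W.IsGloballyMinimal] {p : ℕ} [Fact p.Prime]

omit [W.IsGloballyMinimal] in
/-- **(2.4)∀♭ ⟹ (2.4)∃♭ given Hsieh 2014 Thm. 1**: a ♭-frame with `‖Ω_p‖ = 1` EXISTS at every datum
(`P2.exists_isBDPLFunctionInt_datum_of_hsieh2014_supplied`: Hsieh's fact + the λ-supply at every odd
prime + the glue), and the ∀-shape applies to it. CONDITIONAL on `hH` (published) and (2.4)∀♭ (open);
nothing booked. [cite: Hsieh2014, Thm. 1 (arXiv:1112.1580 pp. 3–4)] [claim: Castella2018Erratum, status: under-review] -/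
theorem P2.imcDivSomeFrameOnTree_of_imcDivAllFrames_of_hsieh2014
    (hH : hsieh2014_exists_anticyclotomicPAdicLFunction) (hA : P2.IMCDivAllFramesOnTree W p) :
    P2.IMCDivSomeFrameOnTree W p := by
  intro N _ K _ _ Dt H ιK P hX h5 hs hN hK hodd hpd hμ hHN hLt hP hc hPinf κ hκ γ _ ι' w₀ P' hP' e he
  obtain ⟨ΩK, Ωp, Q, hΩK, hΩp, hQ⟩ :=
    P2.exists_isBDPLFunctionInt_datum_of_hsieh2014_supplied W p hH Dt hX hN hK hHN κ hκ γ ι' w₀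
  have hΩp0 : Ωp ≠ 0 := fun h ↦ by rw [h, norm_zero] at hΩp; exact zero_ne_one hΩp
  exact ⟨ΩK, Ωp, Q, hΩK, hΩp, hQ, hA N K Dt H ιK P hX h5 hs hN hK hodd hpd hμ hHN hLt hP hc hPinf κ hκ
    γ ι' w₀ P' hP' e he ΩK Ωp Q hΩK hΩp0 hQ⟩

omit [W.IsGloballyMinimal] in
/-- **(2.4) for every Hsieh witness ⟹ (2.4)∃♭ given Hsieh 2014 Thm. 1** (gen 25's
`P2.imcDivSomeFrameOnTree_of_hsieh2014_of_forall_hsiehWitness_dvd`, whose inline hypothesis — stated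
at `‖Ω_p‖ = 1` — is implied by the ∀-Hsieh shape). CONDITIONAL on `hH` and the shape; nothing booked.
[cite: Hsieh2014, Thm. 1 (arXiv:1112.1580 pp. 3–4)] [claim: Castella2018Erratum, status: under-review] -/
theorem P2.imcDivSomeFrameOnTree_of_imcDivHsiehWitness_of_hsieh2014
    (hH : hsieh2014_exists_anticyclotomicPAdicLFunction) (hV : P2.IMCDivHsiehWitnessOnTree W p) :
    P2.IMCDivSomeFrameOnTree W p := by
  refine P2.imcDivSomeFrameOnTree_of_hsieh2014_of_forall_hsiehWitness_dvd hH
    fun N _ K _ _ Dt H ιK P hX h5 hs hN hK hodd hpd hμ hHN hLt hP hc hPinf κ hκ γ _ ι' w₀ P' hP' e he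
      A ΩK C Ωp Q hA0 hΩK hC hΩp hQ => ?_
  have hΩp0 : Ωp ≠ 0 := fun h ↦ by rw [h, norm_zero] at hΩp; exact zero_ne_one hΩp
  exact hV N K Dt H ιK P hX h5 hs hN hK hodd hpd hμ hHN hLt hP hc hPinf κ hκ γ ι' w₀ P' hP' e he A ΩK C
    Ωp Q hA0 hΩK hC hΩp0 hQ

omit [W.IsGloballyMinimal] in
/-- **(2.4)∃♭ ⟺ (2.4)∀♭ given Hsieh 2014 Thm. 1** — route p2's one open statement does not see the
frame. [cite: Hsieh2014, Thm. 1 (arXiv:1112.1580 pp. 3–4)] [cite: Castella2018, Thm. 3.1 (arXiv:1704.06608 p. 9)]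
[claim: Castella2018Erratum, status: under-review] -/
theorem P2.imcDivSomeFrameOnTree_iff_imcDivAllFrames_of_hsieh2014
    (hH : hsieh2014_exists_anticyclotomicPAdicLFunction) :
    P2.IMCDivSomeFrameOnTree W p ↔ P2.IMCDivAllFramesOnTree W p :=
  ⟨P2.imcDivAllFramesOnTree_of_imcDivSomeFrame,
    P2.imcDivSomeFrameOnTree_of_imcDivAllFrames_of_hsieh2014 hH⟩

omit [W.IsGloballyMinimal] in
/-- **(2.4)∃♭ ⟺ (2.4) for EVERY Hsieh witness, given Hsieh 2014 Thm. 1** — route p2's one open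
statement is ONE property of Hsieh's PUBLISHED object `𝒫_Σ(π_f, λ)²` (in any normalisation): the
erratum's divisibility `Ch_Λ(X_ac^∅(E[p^∞]))·𝓞_{ℂ_p}⟦T⟧ ⊆ (𝒫_Σ(π_f,λ)²)`.
[cite: Hsieh2014, Thm. 1 (arXiv:1112.1580 pp. 3–4)] [claim: Castella2018Erratum, status: under-review] -/
theorem P2.imcDivSomeFrameOnTree_iff_imcDivHsiehWitness_of_hsieh2014
    (hH : hsieh2014_exists_anticyclotomicPAdicLFunction) :
    P2.IMCDivSomeFrameOnTree W p ↔ P2.IMCDivHsiehWitnessOnTree W p :=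
  ⟨P2.imcDivHsiehWitnessOnTree_of_imcDivSomeFrame,
    P2.imcDivSomeFrameOnTree_of_imcDivHsiehWitness_of_hsieh2014 hH⟩

omit [W.IsGloballyMinimal] in
/-- **(2.4)∀♭ ⟺ (2.4) for EVERY Hsieh witness, given Hsieh 2014 Thm. 1.**
[cite: Hsieh2014, Thm. 1 (arXiv:1112.1580 pp. 3–4)] [claim: Castella2018Erratum, status: under-review] -/
theorem P2.imcDivAllFramesOnTree_iff_imcDivHsiehWitness_of_hsieh2014
    (hH : hsieh2014_exists_anticyclotomicPAdicLFunction) :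
    P2.IMCDivAllFramesOnTree W p ↔ P2.IMCDivHsiehWitnessOnTree W p :=
  ⟨P2.imcDivHsiehWitnessOnTree_of_imcDivAllFrames, fun h ↦
    P2.imcDivAllFramesOnTree_of_imcDivSomeFrame
      (P2.imcDivSomeFrameOnTree_of_imcDivHsiehWitness_of_hsieh2014 hH h)⟩

end Hsieh

end Summit.BirchSwinnertonDyer.Rank1Residual.X11b

end
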